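import Literature.IUT.HodgeTheaters.PMBaseBridgeProps

/-!
# [IUTchI] §6, Proposition 6.5 (i) and Proposition 6.6 (v) — proved from the interface

Mochizuki, *Inter-universal Teichmüller theory I*, §6, Proposition 6.5 (i) p. 163, kurims manuscript
(May 2020) ([IUTchI] Prop 6.5 (i) p.163) [claim: Mochizuki2012, status: disputed]: "for each `v ∈ 𝕍`, `t ∈ T`, the
`𝒟-Θ^{ell}`-bridge `†φ^{Θell}_±` induces a [single, well-defined!] bijection of sets of ±-label classes of
cusps `†ζ^{Θell}_{v_t} : LabCusp^±(†𝒟_{v_t}) ⥲ LabCusp^±(†𝒟^{⊚±})` that is compatible with the respective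
`𝔽_l^±`-torsor structures". The text says this "follows immediately from the definitions"; here it is
DISCHARGED from the base interface `PMBaseKit` (`PMBaseKit.lean`) for the bridges of
`PMBaseBridges.lean`: every member of `†φ^{Θell}_{v_t}` is a conjugate of
`β ∘ φ^{Θell}_{•,v} ∘ α` (`α ∈ Aut_+(𝒟_v)`, `β` a lift of the translation by the label) by the structure
isomorphisms, positive automorphisms act trivially on `±`-label classes, the lifts act by the
prescribed translation, and each constituent map carries charts to charts.
-/

namespace Literature.IUT.HodgeTheaters

open CategoryTheory

universe u

namespace PMBaseKit

variable {l : ℕ} {K : PMBaseKit.{u} l}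

namespace DThetaEllBridge

/-- The translation by `z ∈ 𝔽_l` of `LabCusp^±(𝒟^{⊚±})`, read through the fixed chart of Example 6.3 (i):
how the lifts `b ∈ Aut_±(𝒟^{⊚±})` of `z` act ([IUTchI] Ex 6.3 (i) p. 161).
([IUTchI] Ex 6.3 (i) p.161) [claim: Mochizuki2012, status: disputed] -/
def gTransl (K : PMBaseKit.{u} l) (z : ZMod l) : Equiv.Perm (K.GLab K.gModel) :=
  K.gChart₀.trans ((FlPM.toPerm l (FlPM.transl z)).trans K.gChart₀.symm)

/-- The translation composed with a torsor chart of `LabCusp^±(𝒟^{⊚±})` is again a torsor chart.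
([IUTchI] Ex 6.3 (i) p.161) [claim: Mochizuki2012, status: disputed] -/
theorem gTransl_trans_mem (z : ZMod l) {e : K.GLab K.gModel ≃ ZMod l} (he : e ∈ K.gLabT.charts) :
    (gTransl K z).trans e ∈ K.gLabT.charts := by
  obtain ⟨g, rfl⟩ := K.gLabT.exists_of_mem K.gChart₀_mem he
  have : (gTransl K z).trans (K.gChart₀.trans (FlPM.toPerm l g)) =
      K.gChart₀.trans (FlPM.toPerm l (g * FlPM.transl z)) := by
    ext x
    simp [gTransl]
  rw [this]
  exact K.gLabT.trans_toPerm_mem K.gChart₀_mem _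

/-- The candidate bijection `†ζ^{Θell}_{v_t}` for `t = ι(z)`, assembled from the structure isomorphisms
`α_z`, `β` of a `𝒟-Θ^{ell}`-bridge: `LabCusp^±` of `α_{z,v}⁻¹`, then the bijection induced by
`φ^{Θell}_{•,v}`, then translation by `z`, then `LabCusp^±` of `β` ([IUTchI] Prop 6.5 (i) p. 163).
([IUTchI] Prop 6.5 (i) p.163) [claim: Mochizuki2012, status: disputed] -/
noncomputable def zetaCandidate (v : K.V) {X : K.Amb v} {G : K.Glob} (αv : K.model v ≅ X) (β : K.gModel ≅ G)
    (z : ZMod l) : K.LabCuspPM v X ≃ K.GLab G :=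
  (K.labMap v αv.symm).trans
    ((Equiv.ofBijective _ (K.labOfHom_phiEll_bijective v)).trans ((gTransl K z).trans (K.gLabMap β)))

/-- **Prop 6.5 (i), first sentence — PROVED**: every `𝒟-Θ^{ell}`-bridge induces the bijections
`†ζ^{Θell}_{v_t}`, compatible with the `𝔽_l^±`-torsor structures.
([IUTchI] Prop 6.5 (i) p.163) [claim: Mochizuki2012, status: disputed] -/
theorem inducesZeta (B : K.DThetaEllBridge) : B.InducesZeta := by
  intro t v
  obtain ⟨ι, hι, α, β, hpoly⟩ := B.exists_model
  obtain ⟨z, rfl⟩ := ι.surjective t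
  refine ⟨zetaCandidate v (α z v) β z, fun h hh => ?_, β, ⟨ι, hι, α, hpoly⟩, fun e he => ?_⟩
  · rw [hpoly z v] at hh
    obtain ⟨f, ⟨a, ha, b, hb, rfl⟩, rfl⟩ := hh
    -- view the automorphisms as isomorphisms (`Aut X := X ≅ X`)
    obtain ⟨a, rfl⟩ : ∃ a' : K.model v ≅ K.model v, a' = a := ⟨a, rfl⟩
    obtain ⟨b, rfl⟩ : ∃ b' : K.gModel ≅ K.gModel, b' = b := ⟨b, rfl⟩
    generalize α z v = αzv
    have ha' : K.labMap v a = Equiv.refl _ := (K.mem_autPlus_iff a).mp ha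
    have hb' : K.gLabMap b = gTransl K z := hb.2
    have e1 : αzv.inv ≫ (a.hom ≫ K.phiEll v ≫ (K.atV v).map b.hom) ≫ (K.atV v).map β.hom =
        (αzv.symm ≪≫ a).hom ≫ (K.phiEll v ≫ (K.atV v).map (b ≪≫ β).hom) := by
      simp [Functor.map_comp, Category.assoc]
    rw [e1, K.labOfHom_pre, K.labOfHom_post, K.labMap_trans, K.gLabMap_trans, ha', hb']
    funext x
    simp [zetaCandidate]
  · unfold zetaCandidate
    rw [Equiv.trans_assoc, Equiv.trans_assoc, Equiv.trans_assoc]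
    -- `e` is a chart of the transported torsor iff `LabCusp^±(β) ≫ e` is a chart of the model
    have he' : (K.gLabMap β).trans e ∈ K.gLabT.charts := he
    -- translate, then use that `φ^{Θell}_{•,v}` carries group charts into torsor charts
    have h2 := gTransl_trans_mem z he'
    set S := K.labPM v (K.model v) ⟨Iso.refl _⟩ with hS
    obtain ⟨g, hg⟩ := K.gLabT.exists_of_mem (K.labOfHom_phiEll_charts v _ S.chart₀_mem) h2
    rw [hg]
    have hsimp : (Equiv.ofBijective _ (K.labOfHom_phiEll_bijective v)).trans
        (((Equiv.ofBijective _ (K.labOfHom_phiEll_bijective v)).symm.trans S.chart₀).trans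
          (FlPM.toPerm l g)) = S.chart₀.trans (FlPM.toPerm l g) := by
      ext x
      simp
    rw [hsimp, ← Equiv.trans_assoc]
    -- `LabCusp^±(α_{z,v}⁻¹)` carries group charts to group charts, hence torsor charts to torsor charts
    set S' := K.labPM v _ ((B.capsule (ι z)).isLocal v) with hS'
    exact S'.toTorsor.trans_toPerm_mem
      (S'.mem_toTorsor_charts (K.labMap_charts v ((B.capsule (ι z)).isLocal v) ⟨Iso.refl _⟩ (α z v).symm
        _ S.chart₀_mem)) g

/-- The value of `†ζ^{Θell}_{v_t}` on any member of `†φ^{Θell}_{v_t}`: with structure isomorphisms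
`α`, `β` exhibiting the bridge and `t = ι(z)`, it is the candidate bijection (positive automorphisms act
trivially on `±`-label classes; lifts of `z` translate by `z`). ([IUTchI] Prop 6.5 (i) p.163) [claim: Mochizuki2012, status: disputed] -/
theorem labOfHom_eq_zetaCandidate (B : K.DThetaEllBridge) {ι : ZMod l ≃ B.T}
    {α : ∀ z, (DStrip.model K).Iso (B.capsule (ι z))} {β : K.gModel ≅ B.glob}
    (hpoly : ∀ z v, B.poly (ι z) v = K.ellConj (α z) β v (Ex63.poly K z v)) (z : ZMod l) (v : K.V)
    {h : (B.capsule (ι z)).obj v ⟶ (K.atV v).obj B.glob} (hh : h ∈ B.poly (ι z) v) :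
    K.labOfHom v h = zetaCandidate v (α z v) β z := by
  rw [hpoly z v] at hh
  obtain ⟨f, ⟨a, ha, b, hb, rfl⟩, rfl⟩ := hh
  obtain ⟨a, rfl⟩ : ∃ a' : K.model v ≅ K.model v, a' = a := ⟨a, rfl⟩
  obtain ⟨b, rfl⟩ : ∃ b' : K.gModel ≅ K.gModel, b' = b := ⟨b, rfl⟩
  generalize α z v = αzv
  have ha' : K.labMap v a = Equiv.refl _ := (K.mem_autPlus_iff a).mp ha
  have hb' : K.gLabMap b = gTransl K z := hb.2
  have e1 : αzv.inv ≫ (a.hom ≫ K.phiEll v ≫ (K.atV v).map b.hom) ≫ (K.atV v).map β.hom =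
      (αzv.symm ≪≫ a).hom ≫ (K.phiEll v ≫ (K.atV v).map (b ≪≫ β).hom) := by
    simp [Functor.map_comp, Category.assoc]
  rw [e1, K.labOfHom_pre, K.labOfHom_post, K.labMap_trans, K.gLabMap_trans, ha', hb']
  funext x
  simp [zetaCandidate]

/-- The translation by `z` is a `±`-automorphism of the torsor `LabCusp^±(𝒟^{⊚±})` (read in the fixed
chart it is `transl z ∈ 𝔽_l^{⋊±}`). ([IUTchI] Ex 6.3 (i) p.161) [claim: Mochizuki2012, status: disputed] -/
theorem gTransl_mem_autPM (z : ZMod l) : gTransl K z ∈ K.gLabT.autPM := by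
  rw [K.gLabT.mem_autPM_iff_exists]
  refine ⟨K.gChart₀, K.gChart₀_mem, FlPM.transl z, fun t => ?_⟩
  simp [gTransl]

/-- Every constituent poly-morphism `†φ^{Θell}_{v_t}` of a `𝒟-Θ^{ell}`-bridge is nonempty (lifts of the
translation exist in `Aut_±(𝒟^{⊚±})` by Def 6.1 (v)). ([IUTchI] Def 6.4 (ii) p.163) [claim: Mochizuki2012, status: disputed] -/
theorem poly_nonempty (B : K.DThetaEllBridge) (t : B.T) (v : K.V) : (B.poly t v).Nonempty := by
  obtain ⟨ι, -, α, β, hpoly⟩ := B.exists_model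
  obtain ⟨z, rfl⟩ := ι.surjective t
  obtain ⟨b, hb1, hb2⟩ := (K.gLab_range (gTransl K z)).mp (gTransl_mem_autPM z)
  refine ⟨(α z v).inv ≫ ((1 : Aut (K.model v)).hom ≫ K.phiEll v ≫ (K.atV v).map b.hom) ≫
    (K.atV v).map β.hom, ?_⟩
  rw [hpoly z v]
  exact ⟨_, ⟨1, one_mem _, b, ⟨(K.mem_autPMg_iff b).mpr hb1, hb2⟩, rfl⟩, rfl⟩

/-- **Prop 6.5 (i), second sentence — PROVED from the synchronisation law of Example 6.3 (i)**
(`Ex63.PhiEllSync`): for a `𝒟-Θ^{ell}`-bridge, `†ξ^{Θell}_{v_t,w_t} = (†ζ^{Θell}_{w_t})⁻¹ ∘ †ζ^{Θell}_{v_t}` is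
compatible with the `𝔽_l^±`-group structures ([IUTchI] Prop 6.5 (i) p. 164; audit abc-iut-L5-t6
R7-L5t4-F1: the law is needed). ([IUTchI] Prop 6.5 (i) p.164) [claim: Mochizuki2012, status: disputed] -/
theorem xiGroupCompat_of_sync (hsync : Ex63.PhiEllSync K) (B : K.DThetaEllBridge) : B.XiGroupCompat := by
  intro t v w ζv ζw hv hw
  obtain ⟨ι, hι, α, β, hpoly⟩ := B.exists_model
  obtain ⟨z, rfl⟩ := ι.surjective t
  obtain ⟨fv, hfv⟩ := B.poly_nonempty (ι z) v
  obtain ⟨fw, hfw⟩ := B.poly_nonempty (ι z) w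
  have hζv : ζv = zetaCandidate v (α z v) β z :=
    Equiv.ext fun x => by rw [← hv.1 fv hfv, B.labOfHom_eq_zetaCandidate hpoly z v hfv]
  have hζw : ζw = zetaCandidate w (α z w) β z :=
    Equiv.ext fun x => by rw [← hw.1 fw hfw, B.labOfHom_eq_zetaCandidate hpoly z w hfw]
  subst hζv hζw
  -- the global parts cancel: `ξ = LabCusp^±(α_v⁻¹) ≫ E_v ≫ E_w⁻¹ ≫ LabCusp^±(α_w)`
  set Ev := Equiv.ofBijective _ (K.labOfHom_phiEll_bijective v) with hEv
  set Ew := Equiv.ofBijective _ (K.labOfHom_phiEll_bijective w) with hEw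
  have hξ : (zetaCandidate v (α z v) β z).trans (zetaCandidate w (α z w) β z).symm =
      (K.labMap v (α z v).symm).trans (Ev.trans (Ew.symm.trans (K.labMap w (α z w).symm).symm)) := by
    ext x
    simp [zetaCandidate, hEv, hEw]
  rw [hξ]
  intro c hc
  -- pull the chart `c` of `LabCusp^±(†𝒟_{w_t})` back along the four maps
  set Sv := K.labPM v (K.model v) ⟨Iso.refl _⟩ with hSv
  set Sw := K.labPM w (K.model w) ⟨Iso.refl _⟩ with hSw
  have h1 : (K.labMap w (α z w).symm).symm.trans c ∈ Sw.charts := by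
    rw [← PMBaseKit.labMap_symm, Iso.symm_symm_eq]
    exact K.labMap_charts w ⟨Iso.refl _⟩ ((B.capsule (ι z)).isLocal w) (α z w) c hc
  obtain ⟨εw, hεw⟩ := hsync w _ h1
  obtain ⟨εv, hεv⟩ := hsync v _ Sv.chart₀_mem
  rw [← hEw] at hεw
  rw [← hEv] at hεv
  have hg : ∀ y, K.gChart₀ y = εv⁻¹ • Sv.chart₀ (Ev.symm y) := fun y => by
    have := congrArg (fun f => f y) hεv
    simp only [Equiv.trans_apply, signPerm_apply] at this
    rw [this, inv_smul_smul]
  have h2 : Ev.trans (Ew.symm.trans (((K.labMap w (α z w).symm).symm).trans c)) =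
      Sv.chart₀.trans (signPerm l (εv⁻¹ * εw)) := by
    rw [hεw]
    ext x
    simp only [Equiv.trans_apply, signPerm_apply, hg, Equiv.symm_apply_apply]
    rw [mul_comm, mul_smul]
  have hfinal : ((K.labMap v (α z v).symm).trans (Ev.trans (Ew.symm.trans (K.labMap w (α z w).symm).symm))).trans c
      = (K.labMap v (α z v).symm).trans (Sv.chart₀.trans (signPerm l (εv⁻¹ * εw))) := by
    rw [Equiv.trans_assoc, Equiv.trans_assoc, Equiv.trans_assoc, h2]
  exact hfinal ▸ K.labMap_charts v ((B.capsule (ι z)).isLocal v) ⟨Iso.refl _⟩ (α z v).symm _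
    (Sv.trans_signPerm_mem Sv.chart₀_mem _)

end DThetaEllBridge

end PMBaseKit

end Literature.IUT.HodgeTheaters


/-!
# [IUTchI] §6, Proposition 6.6 (v) — proved from the interface

Mochizuki, *Inter-universal Teichmüller theory I*, §6, Proposition 6.6 (v) p. 166, kurims manuscript
(May 2020) ([IUTchI] Prop 6.6 (v) p.166) [claim: Mochizuki2012, status: disputed]: "Given a `𝒟-Θ^{ell}`-bridge, there exists a
[relatively simple — cf. the discussion of Example 6.2, (i)] functorial algorithm for constructing, up
to an `𝔽_l^{⋊±}`-indeterminacy [cf. (ii), (iv)], from the given `𝒟-Θ^{ell}`-bridge a `𝒟-Θ^{±ell}`-Hodge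
theater whose underlying `𝒟-Θ^{ell}`-bridge is the given `𝒟-Θ^{ell}`-bridge." DISCHARGED here for the
bridges of `PMBaseBridges.lean` over the base interface `PMBaseKit`: transport the `𝔽_l^±`-group
structure of `𝔽_l` and the model `Θ^±`-bridge of Example 6.2 (i) along the structure isomorphisms
`𝔇_± ⥲ †𝔇_T` of the given bridge (the choice of these isomorphisms is the printed
`𝔽_l^{⋊±}`-indeterminacy), and check that the identity capsule-`+`-full poly-isomorphism is an
isomorphism of `𝒟-Θ^{ell}`-bridges — the one computation being that `Aut_+(†𝒟_{v_t}) · †φ^{Θell}_{v_t} =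
†φ^{Θell}_{v_t} · Aut_csp(†𝒟^{⊚±})` as poly-morphisms.
-/

namespace Literature.IUT.HodgeTheaters

open CategoryTheory

universe u

namespace FlPMGroup

variable {l : ℕ} {T : Type*}

/-- The `𝔽_l^±`-group structure on `T` transported along a bijection `ι : 𝔽_l ⥲ T` (the structure
"`𝔇_± ⥲ †𝔇_T` … determine[s] an isomorphism of `𝔽_l^±`-groups", [IUTchI] Def 6.4 (i) p. 162).
([IUTchI] Def 6.4 (i) p.162) [claim: Mochizuki2012, status: disputed] -/
def ofEquiv (ι : ZMod l ≃ T) : FlPMGroup l T where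
  charts := Set.range fun ε : ℤˣ => ι.symm.trans (signPerm l ε)
  nonempty := ⟨_, 1, rfl⟩
  eq_orbit := by
    rintro e ⟨ε, rfl⟩
    ext f
    constructor
    · rintro ⟨η, rfl⟩
      exact ⟨η * ε⁻¹, by ext t; simp only [Equiv.trans_apply, signPerm_apply, smul_smul, inv_mul_cancel_right]⟩
    · rintro ⟨η, rfl⟩
      exact ⟨η * ε, by ext t; simp only [Equiv.trans_apply, signPerm_apply, smul_smul]⟩

/-- `ι` is an isomorphism of `𝔽_l^±`-groups from the tautological structure to the transported one.
([IUTchI] Def 6.4 (i) p.162) [claim: Mochizuki2012, status: disputed] -/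
theorem ofEquiv_compat (ι : ZMod l ≃ T) :
    ∀ e ∈ (ofEquiv ι).charts, ι.trans e ∈ (FlPMGroup.tautological l).charts := by
  rintro e ⟨ε, rfl⟩
  exact ⟨ε, by ext x; simp⟩

/-- Torsor charts compatible with `ι` are charts of the torsor structure induced by the transported
group structure. ([IUTchI] Def 6.4 (iii) p.163) [claim: Mochizuki2012, status: disputed] -/
theorem mem_ofEquiv_toTorsor (ι : ZMod l ≃ T) {e : T ≃ ZMod l}
    (he : ι.trans e ∈ (FlPMTorsor.tautological l).charts) : e ∈ (ofEquiv ι).toTorsor.charts := by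
  obtain ⟨g, hg⟩ := he
  refine ⟨ι.symm.trans (signPerm l 1), ⟨1, rfl⟩, g, ?_⟩
  ext t
  have := congrArg (fun σ => σ (ι.symm t)) hg
  simp only [Equiv.trans_apply, Equiv.apply_symm_apply, FlPM.toPerm_apply] at this
  simp only [Equiv.trans_apply, signPerm_apply, one_smul, FlPM.toPerm_apply, this]

end FlPMGroup

namespace PMBaseKit

variable {l : ℕ} {K : PMBaseKit.{u} l}

/-! ### `Aut_+ · †φ^{Θell} = †φ^{Θell} · Aut_csp` -/

/-- Pre-composing a member of (a conjugate of) the model `Θ^{ell}`-poly-morphism with a positive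
automorphism gives again a member. ([IUTchI] Ex 6.3 (i) p.161) [claim: Mochizuki2012, status: disputed] -/
theorem ellConj_pre_mem {v : K.V} {D : K.DStrip} {G : K.Glob} (α : (DStrip.model K).Iso D) (β : K.gModel ≅ G)
    (z : ZMod l) {p : D.obj v ≅ D.obj v} (hp : K.labMap v p = Equiv.refl _)
    {h : D.obj v ⟶ (K.atV v).obj G} (hh : h ∈ K.ellConj α β v (Ex63.poly K z v)) :
    p.hom ≫ h ∈ K.ellConj α β v (Ex63.poly K z v) := by
  obtain ⟨f, ⟨a, ha, b, hb, rfl⟩, rfl⟩ := hh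
  obtain ⟨a, rfl⟩ : ∃ a' : K.model v ≅ K.model v, a' = a := ⟨a, rfl⟩
  generalize hαv : α v = αv at *
  have ha' : K.labMap v a = Equiv.refl _ := (K.mem_autPlus_iff a).mp ha
  refine ⟨((αv ≪≫ p ≪≫ αv.symm) ≪≫ a).hom ≫ K.phiEll v ≫ (K.atV v).map b.hom,
    ⟨(αv ≪≫ p ≪≫ αv.symm) ≪≫ a, ?_, b, hb, rfl⟩, ?_⟩
  · rw [mem_autPlus_iff]
    show K.labMap v ((αv ≪≫ p ≪≫ αv.symm) ≪≫ a) = _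
    rw [K.labMap_trans, K.labMap_trans, K.labMap_trans, hp, ha']
    simp [← K.labMap_trans, K.labMap_refl]
  · simp [hαv]

/-- Post-composing a member with (the image of) an automorphism of `†𝒟^{⊚±}` acting trivially on
`±`-label classes gives again a member. ([IUTchI] Ex 6.3 (i) p.161) [claim: Mochizuki2012, status: disputed] -/
theorem ellConj_post_mem {v : K.V} {D : K.DStrip} {G : K.Glob} (α : (DStrip.model K).Iso D) (β : K.gModel ≅ G)
    (z : ZMod l) {c : G ≅ G} (hc : K.gLabMap c = Equiv.refl _)
    {h : D.obj v ⟶ (K.atV v).obj G} (hh : h ∈ K.ellConj α β v (Ex63.poly K z v)) :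
    h ≫ (K.atV v).map c.hom ∈ K.ellConj α β v (Ex63.poly K z v) := by
  obtain ⟨f, ⟨a, ha, b, hb, rfl⟩, rfl⟩ := hh
  set c' : Aut K.gModel := β ≪≫ c ≪≫ β.symm with hc'def
  have hc' : K.gLabMap c' = Equiv.refl _ := by
    simp only [hc'def, K.gLabMap_trans, hc, Equiv.refl_trans, ← K.gLabMap_trans β β.symm, Iso.self_symm_id,
      K.gLabMap_refl]
  have hcsp : c' ∈ K.autCsp K.gModel := MonoidHom.mem_ker.mpr hc'
  have hlab : K.gLabMap (c' * b) = K.gChart₀.trans ((FlPM.toPerm l (FlPM.transl z)).trans K.gChart₀.symm) := by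
    have hmul := (K.gLabAct K.gModel).map_mul c' b
    change K.gLabMap (c' * b) = K.gLabMap c' * K.gLabMap b at hmul
    rw [hmul, hc', hb.2]
    rfl
  refine ⟨a.hom ≫ K.phiEll v ≫ (K.atV v).map (c' * b).hom,
    ⟨a, ha, c' * b, ⟨(K.autPMg K.gModel).mul_mem (K.autCsp_le_autPMg _ hcsp) hb.1, hlab⟩, rfl⟩, ?_⟩
  simp [Aut.Aut_mul_def, hc'def, Functor.map_comp]

/-! ### Proposition 6.6 (v) -/

/-- Transport of a family of isomorphisms of `𝒟`-prime-strips along an equality of indices.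
([IUTchI] Def 6.4 (i) p.162) [claim: Mochizuki2012, status: disputed] -/
theorem DStrip.isoCast_eq {S : Type} (C : S → K.DStrip) (D : K.DStrip) (α : ∀ s, D.Iso (C s))
    {s₁ s₂ : S} (e : s₁ = s₂) :
    (fun v => α s₁ v ≪≫ eqToIso (congrArg (fun s => (C s).obj v) e)) = α s₂ := by
  subst e
  funext v
  simp

/-- **Prop 6.6 (v) — PROVED** from the interface: every `𝒟-Θ^{ell}`-bridge is (isomorphic, via the
identity capsule-`+`-full poly-isomorphism and the `Aut_csp`-orbit of the identity, to) the underlying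
`𝒟-Θ^{ell}`-bridge of a `𝒟-Θ^{±ell}`-Hodge theater, obtained by transporting the model `Θ^±`-bridge of
Example 6.2 (i) along the structure isomorphisms of the given bridge.
([IUTchI] Prop 6.6 (v) p.166) [claim: Mochizuki2012, status: disputed] -/
theorem DThetaEllBridge.extendsToHT (B' : K.DThetaEllBridge) : ExtendsToHT B' := by
  obtain ⟨ι, hι, α, β, hpoly⟩ := B'.exists_model
  letI := B'.fintypeT
  let α' : ∀ t : B'.T, (DStrip.model K).Iso (B'.capsule t) := fun t v =>
    α (ι.symm t) v ≪≫ eqToIso (congrArg (fun s => (B'.capsule s).obj v) (ι.apply_symm_apply t))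
  have hα' : ∀ z, α' (ι z) = α z := fun z =>
    DStrip.isoCast_eq (fun s => B'.capsule (ι s)) _ α (ι.symm_apply_apply z)
  let H : K.DThetaPMEllHT :=
    { T := B'.T
      grpT := FlPMGroup.ofEquiv ι
      capsule := B'.capsule
      codomain := DStrip.model K
      polyPM := fun t => DStrip.polyConj (α' t) (DStrip.Iso.refl _) (Ex62.poly K (ι.symm t))
      glob := B'.glob
      polyEll := B'.poly
      exists_model := ⟨ι, FlPMGroup.ofEquiv_compat ι, α, DStrip.Iso.refl _, β,
        fun z => by simp only [hα']; rfl, hpoly⟩ }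
  refine ⟨H, ⟨{ indexEquiv := Equiv.refl _
                indexEquiv_charts := fun e he => FlPMGroup.mem_ofEquiv_toTorsor ι (hι e he)
                capsPoly := fun t => DStrip.plusFullPolyIso (DStrip.Iso.refl (B'.capsule t))
                capsPoly_plusFull := fun t => ⟨_, rfl⟩
                globPoly := {ψ | ∃ c ∈ K.autCsp B'.glob, ψ = Iso.refl _ ≪≫ c}
                globPoly_orbit := ⟨Iso.refl _, rfl⟩
                compat := fun t v => ?_ }⟩⟩
  obtain ⟨z, rfl⟩ := ι.surjective t
  change {h | ∃ p ∈ DStrip.plusFullPolyIso (DStrip.Iso.refl (B'.capsule (ι z))),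
      ∃ g ∈ B'.poly (ι z) v, h = (p v).hom ≫ g} =
    {h | ∃ f ∈ B'.poly (ι z) v, ∃ q ∈ {ψ | ∃ c ∈ K.autCsp B'.glob, ψ = Iso.refl _ ≪≫ c},
      h = f ≫ (K.atV v).map (q : B'.glob ≅ B'.glob).hom}
  rw [hpoly z v]
  ext h
  constructor
  · rintro ⟨p, ⟨a, ha, rfl⟩, g, hg, rfl⟩
    have hav : K.labMap v (a v) = Equiv.refl _ :=
      (K.mem_autPlus_iff _).mp (((B'.capsule (ι z)).mem_autPlus_iff a).mp ha v)
    have hap : K.labMap v (Iso.refl _ ≪≫ a v) = Equiv.refl _ := by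
      simp only [K.labMap_trans, K.labMap_refl, hav, Equiv.refl_trans]
    exact ⟨_, K.ellConj_pre_mem (α z) β z hap hg, Iso.refl _ ≪≫ Iso.refl _, ⟨1, one_mem _, rfl⟩,
      by simp [DStrip.Iso.refl]⟩
  · rintro ⟨f, hf, q, ⟨c, hc, rfl⟩, rfl⟩
    obtain ⟨c, rfl⟩ : ∃ c' : B'.glob ≅ B'.glob, c' = c := ⟨c, rfl⟩
    have hc' : K.gLabMap c = Equiv.refl _ := MonoidHom.mem_ker.mp hc
    refine ⟨DStrip.Iso.refl _, ⟨1, one_mem _, funext fun w => ?_⟩,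
      f ≫ (K.atV v).map c.hom, K.ellConj_post_mem (α z) β z hc' hf, by simp [DStrip.Iso.refl]⟩
    simp [DStrip.Iso.refl]
    rfl

/-- `ExtendsToHT` holds for all parameters — `_holds` alias of `extendsToHT` above under the fact's exact name
(appended 2026-08-28, D-0026 bookkeeping: the proof term is the existing theorem of this file; no statement,
definition or attribute is edited; no new named fact; the ledger's debt table listed the fact
unproved). [claim: Mochizuki2012, status: disputed] -/
theorem _root_.Literature.IUT.HodgeTheaters.PMBaseKit.ExtendsToHT_holds (B' : K.DThetaEllBridge) :
    ExtendsToHT B' :=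
  _root_.Literature.IUT.HodgeTheaters.PMBaseKit.DThetaEllBridge.extendsToHT B'

end PMBaseKit

end Literature.IUT.HodgeTheaters
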